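import Mathlib
import Summits.ValiantsHypothesis.ValiantsHypothesis.Theorems.NewtonUnitEquationsDissociatedUniformTotalsLawExposure
import HarnessLib

/-!
# Crux `NewtonUnitEquations.DissociatedUniform` (stmt-ValiantsHypothesis-5905): the `n = 3` totals law — POCKETS: a point is exposed by at
# most three single deletions, so the pockets of a finite planar set have total size `≤ 3·(#points − #vertices)`

Companion of `…TotalsLawExposure` (`exists_witnesses`: a non-vertex `u` of a finite planar `S` has `≤ 3` witnesses `T ⊆ S ∖ {u}` with
`u ∈ conv T`; `exists_witness_not_mem`: if `u` is a hull vertex of `S'` then a witness is missing from `S'`).  The POCKET of a point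
`p ∈ S` is the set of non-vertices of `S` that become hull vertices of `S ∖ {p}`.  PROVED (pure planar convexity):
* `mem_witnesses_of_exposed` — if deleting `p` exposes `u` then `p` is one of the (≤ 3) witnesses of `u`;
* **`card_exposers_le_three`** — every non-vertex `u` lies in at most `3` pockets;
* **`sum_card_pockets_le`** — `∑_{p ∈ S} #pocket(p) ≤ 3 · #{non-vertices of S} ≤ 3·#S` (double counting).
Use (memo `Cruxes/DissociatedUniform/NOTES-t1g11.md` §2, §6(ii)): with `…UnionVertBound.top_dichotomy_of_one_missing`, the hull vertices of
`(A + B) ∖ P_r` (one fibre missing) are `top(A) +` (a point of `B` or of a pocket of `B`) or symmetric, which is the route to a SHARP pointwise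
bound `O(q)` with a one-digit constant for the union rung `UnionVertBound`; the sharper "≤ 2 pockets" needs the cone-covering lemma (not here).
Honest label: tool lemmas; the union law and `TotalsLawThree` remain OPEN; nothing here bears on VP ≠ VNP.
[folklore: Carathéodory]
-/

set_option linter.dupNamespace false -- `ValiantsHypothesis.ValiantsHypothesis` (summit = problem) in every name

open scoped BigOperators

namespace Summit.ValiantsHypothesis.ValiantsHypothesis.Theorems.NewtonUnitEquationsDissociatedUniform

namespace TotalsLaw

/-- **An exposer is a witness.**  If `u ∈ conv T` with `u ∉ T`, `T ⊆ S`, and `u` is a hull vertex of `S ∖ {p}`, then `p ∈ T`. [folklore] -/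
theorem mem_witnesses_of_exposed {S T : Finset (Fin 2 → ℝ)} {u p : Fin 2 → ℝ} (hTS : T ⊆ S)
    (huT : u ∈ convexHull ℝ (T : Set (Fin 2 → ℝ))) (hTu : u ∉ T)
    (hexp : u ∈ (convexHull ℝ ((S.erase p : Finset (Fin 2 → ℝ)) : Set (Fin 2 → ℝ))).extremePoints ℝ) : p ∈ T := by
  classical
  obtain ⟨v, hvT, hvS'⟩ := exists_witness_not_mem huT hTu hexp
  rw [Finset.mem_coe, Finset.mem_erase, not_and_or, not_not] at hvS'
  rcases hvS' with h | h
  · rw [h] at hvT; exact hvT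
  · exact absurd (hTS hvT) h

open Classical in
/-- **At most three pockets contain a given point**: a non-vertex `u` of a finite planar set `S` is a hull vertex of `S ∖ {p}` for at
most `3` points `p ∈ S` (all of them witnesses of `u`). [folklore] -/
theorem card_exposers_le_three (S : Finset (Fin 2 → ℝ)) {u : Fin 2 → ℝ} (huS : u ∈ S)
    (hne : u ∉ (convexHull ℝ (S : Set (Fin 2 → ℝ))).extremePoints ℝ) :
    (S.filter fun p => u ∈ (convexHull ℝ ((S.erase p : Finset (Fin 2 → ℝ)) : Set (Fin 2 → ℝ))).extremePoints ℝ).card ≤ 3 := by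
  classical
  obtain ⟨T, hTsub, hTcard, huT⟩ := exists_witnesses (Finset.finite_toSet S) (Finset.mem_coe.2 huS) hne
  have hTS : T ⊆ S := fun v hv => (hTsub (Finset.mem_coe.2 hv)).1
  have hTu : u ∉ T := fun h => (hTsub (Finset.mem_coe.2 h)).2 (Set.mem_singleton u)
  calc (S.filter fun p => u ∈ (convexHull ℝ ((S.erase p : Finset (Fin 2 → ℝ)) : Set (Fin 2 → ℝ))).extremePoints ℝ).card
      ≤ T.card := Finset.card_le_card fun p hp => mem_witnesses_of_exposed hTS huT hTu (Finset.mem_filter.1 hp).2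
    _ ≤ 3 := hTcard

open Classical in
/-- **Pocket inequality.**  Summed over the points `p` of a finite planar set `S`, the numbers of non-vertices of `S` exposed by deleting
`p` total at most `3 · #{non-vertices of S}`. [folklore] -/
theorem sum_card_pockets_le (S : Finset (Fin 2 → ℝ)) :
    ∑ p ∈ S, (S.filter fun u => u ∉ (convexHull ℝ (S : Set (Fin 2 → ℝ))).extremePoints ℝ ∧
        u ∈ (convexHull ℝ ((S.erase p : Finset (Fin 2 → ℝ)) : Set (Fin 2 → ℝ))).extremePoints ℝ).card ≤
      3 * (S.filter fun u => u ∉ (convexHull ℝ (S : Set (Fin 2 → ℝ))).extremePoints ℝ).card := by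
  classical
  -- double count the pairs (p, u)
  calc ∑ p ∈ S, (S.filter fun u => u ∉ (convexHull ℝ (S : Set (Fin 2 → ℝ))).extremePoints ℝ ∧
          u ∈ (convexHull ℝ ((S.erase p : Finset (Fin 2 → ℝ)) : Set (Fin 2 → ℝ))).extremePoints ℝ).card
      = ∑ p ∈ S, ∑ u ∈ S, (if (u ∉ (convexHull ℝ (S : Set (Fin 2 → ℝ))).extremePoints ℝ ∧
          u ∈ (convexHull ℝ ((S.erase p : Finset (Fin 2 → ℝ)) : Set (Fin 2 → ℝ))).extremePoints ℝ) then 1 else 0) :=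
        Finset.sum_congr rfl fun p _ => Finset.card_filter _ _
    _ = ∑ u ∈ S, ∑ p ∈ S, (if (u ∉ (convexHull ℝ (S : Set (Fin 2 → ℝ))).extremePoints ℝ ∧
          u ∈ (convexHull ℝ ((S.erase p : Finset (Fin 2 → ℝ)) : Set (Fin 2 → ℝ))).extremePoints ℝ) then 1 else 0) :=
        Finset.sum_comm
    _ = ∑ u ∈ S, (S.filter fun p => u ∉ (convexHull ℝ (S : Set (Fin 2 → ℝ))).extremePoints ℝ ∧
          u ∈ (convexHull ℝ ((S.erase p : Finset (Fin 2 → ℝ)) : Set (Fin 2 → ℝ))).extremePoints ℝ).card :=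
        Finset.sum_congr rfl fun u _ => (Finset.card_filter _ _).symm
    _ ≤ ∑ u ∈ S, (if u ∉ (convexHull ℝ (S : Set (Fin 2 → ℝ))).extremePoints ℝ then 3 else 0) := by
        refine Finset.sum_le_sum fun u hu => ?_
        by_cases hne : u ∉ (convexHull ℝ (S : Set (Fin 2 → ℝ))).extremePoints ℝ
        · simp only [hne, not_false_eq_true, true_and, if_true]
          exact card_exposers_le_three S hu hne
        · have h0 : (S.filter fun p => u ∉ (convexHull ℝ (S : Set (Fin 2 → ℝ))).extremePoints ℝ ∧
              u ∈ (convexHull ℝ ((S.erase p : Finset (Fin 2 → ℝ)) : Set (Fin 2 → ℝ))).extremePoints ℝ) = ∅ :=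
            Finset.filter_eq_empty_iff.2 fun p _ h => hne h.1
          rw [h0, Finset.card_empty]
          simp only [hne, if_false]
          exact le_rfl
    _ = 3 * (S.filter fun u => u ∉ (convexHull ℝ (S : Set (Fin 2 → ℝ))).extremePoints ℝ).card := by
        rw [Finset.card_filter, Finset.mul_sum]
        refine Finset.sum_congr rfl fun u _ => ?_
        split_ifs <;> simp

open Classical in
/-- Coarse form: **`∑_{p ∈ S} #pocket(p) ≤ 3·#S`**. [folklore] -/
theorem sum_card_pockets_le_card (S : Finset (Fin 2 → ℝ)) :
    ∑ p ∈ S, (S.filter fun u => u ∉ (convexHull ℝ (S : Set (Fin 2 → ℝ))).extremePoints ℝ ∧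
        u ∈ (convexHull ℝ ((S.erase p : Finset (Fin 2 → ℝ)) : Set (Fin 2 → ℝ))).extremePoints ℝ).card ≤ 3 * S.card := by
  have h := sum_card_pockets_le S
  have h2 : (S.filter fun u => u ∉ (convexHull ℝ (S : Set (Fin 2 → ℝ))).extremePoints ℝ).card ≤ S.card :=
    Finset.card_filter_le _ _
  omega

end TotalsLaw

end Summit.ValiantsHypothesis.ValiantsHypothesis.Theorems.NewtonUnitEquationsDissociatedUniform
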